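import Summits.QuantumFields.BalabanUV.T4Continuum.Support.VariationalVectorGaugeSliceTower
import Summits.QuantumFields.BalabanUV.T4Continuum.Support.VariationalVectorFederbushLinePhys

/-!
# T⁴ programme, spine node NE2 (U1a), lane P2 — LEAF V-GF, file 7: THE CURL-FEDERBUSH SOCKET OF THE SLICE END AT `U = 1` (`δ k = 0`) —
# leaf-01-g5's `ScV_QvL_line_le_curl` at flat data (mismatch `m₀ = 0`, plaquette defect `a = 0`): «averaging decreases the curl action», constant exactly 1 (model level)

NE2 formalisation swarm `b2b-balaban-t4-ne2-formalise-*`, leaf prover 09 GEN 7 (`prover-b2b-balaban-t4-ne2-formalise-leaf-09-g7-0`); follows files 1–6.  On top of leaf-01-g5's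
`VariationalVectorFederbushLinePhys.ScV_QvL_line_le_curl` (p218349) and `VariationalVectorExterior.misv_flat` (p218348), file 1's `lineT_flat` — BY NAME.  This file is
G-free: it only reads the flat instance of the curl Federbush into the exact letters of `VariationalVectorEndOfLeavesSlice.towerLimitRate_effV_of_leaves_slice`'s binder
`hFEDcurl k` (p221732), so that at flat data the slice END for Bałaban's gauge functional (files 4–6) has ONLY `hONE`, `hREG` and the constant bookkeeping displayed.
 * **`hFEDcurl_flat`**: `ScV n M 1 0 (QvL L (fine n M) 1 W′) ≤ (√(SfV n L M 1 0 W′) + 0·√(qVV n L M W′))²`; tower form **`hFEDcurl_tower`** (`δ k = 0` for every `k`).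

HONEST FRAMING (T4-DAG p. 1).  Model level; flat data; [folklore] instantiation; nothing printed is a hypothesis; no `def`, no `def … : Prop`, no `sorry`; axioms standard.
V-END ∕ NE2 NOT proved; NE3 OPEN; spine PROVED 0∕9 unchanged; rung (B)+1 finite T⁴ — NOT infinite volume, NOT mass gap, NOT Clay.  HONEST DEPENDENCY (cell, verbatim):
continuum YM on T⁴ ⇐ BetaPertH ∧ nine spine estimates (0/9 proved); BetaPertH ⇐ (D1) ∧ (D4) ∧ CAP+tail; G-an2-4 gates asym, D1 and NE2/3/4.
-/

noncomputable section

namespace Summit.QuantumFields.BalabanUV.T4Continuum.VariationalVectorGaugeSliceFED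

open Literature.MathematicalPhysics.QuantumFieldTheory.Balaban1983to89.B5Prop11Plancherel (Tor fine unitVec)
open Summit.QuantumFields.BalabanUV.T4Continuum.VariationalVectorForm (ScV SfV qVV SfV_nonneg)
open Summit.QuantumFields.BalabanUV.T4Continuum.VectorBlockTrialForm (QvL)
open Summit.QuantumFields.BalabanUV.T4Continuum.VariationalVectorFederbush (lineT ScV_QvL_line_le_curl)
open Summit.QuantumFields.BalabanUV.T4Continuum.VariationalVectorExterior (misv_flat)
open Summit.QuantumFields.BalabanUV.T4Continuum.VariationalVectorGaugeSlice (lineT_flat)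
open Summit.QuantumFields.BalabanUV.T4Continuum.VariationalVectorGaugeSliceB5 (flatR)

variable {d : ℕ} {E : Type*} [NormedAddCommGroup E] [NormedSpace ℂ E]
variable (n L : ℕ) [NeZero n] [NeZero L] (M : Fin d → ℕ) [hM : ∀ μ, NeZero (M μ)]

/-- **THE CURL FEDERBUSH AT FLAT DATA, IN THE SLICE END's LETTERS** (`δ = 0`): `ScV n M 1 0 (Q_1 W′) ≤ (√(SfV n L M 1 0 W′) + 0·√(qVV W′))²`. [folklore] -/
theorem hFEDcurl_flat (W' : Tor (fine L (fine n M)) → Fin d → E) :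
    ScV n M (fun _ _ => (1 : E →L[ℂ] E)) (fun _ => 0) (QvL L (fine n M) (fun _ _ _ _ => (1 : E →L[ℂ] E)) W')
      ≤ (Real.sqrt (SfV n L M (fun _ _ => (1 : E →L[ℂ] E)) (fun _ => 0) W') + 0 * Real.sqrt (qVV n L M W')) ^ 2 := by
  have h := ScV_QvL_line_le_curl n L M (Rc := fun _ _ => (1 : E →L[ℂ] E)) (R' := fun _ _ => (1 : E →L[ℂ] E)) (T' := fun _ => (1 : E →L[ℂ] E))
    (fun _ _ => ContinuousLinearMap.norm_id_le) (fun _ => ContinuousLinearMap.norm_id_le) (m₀ := 0) (a := 0) le_rfl le_rfl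
    (fun y μ j => by rw [misv_flat, norm_zero]) (fun x κ ι => by simp) (G' := fun _ => 0) (fun _ => le_rfl) W'
  rw [lineT_flat] at h
  simpa using h

/-- tower form: the slice END's `hFEDcurl k` at flat data with `δ k = 0` (`E = ℂ`, any `L`, every level `L^k`). [folklore] -/
theorem hFEDcurl_tower (k : ℕ) (W' : Tor (fine L (fine (L ^ k) M)) → Fin d → ℂ) :
    ScV (L ^ k) M (flatR (L ^ k) M) (fun _ => 0) (QvL L (fine (L ^ k) M) (fun _ _ _ _ => (1 : ℂ →L[ℂ] ℂ)) W')
      ≤ (Real.sqrt (SfV (L ^ k) L M (flatR L (fine (L ^ k) M)) (fun _ => 0) W') + 0 * Real.sqrt (qVV (L ^ k) L M W')) ^ 2 :=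
  hFEDcurl_flat (L ^ k) L M W'

end Summit.QuantumFields.BalabanUV.T4Continuum.VariationalVectorGaugeSliceFED

end
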